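import Literature.Probability.LatticeModels.ObservableLimitHolomorphic
import Literature.Probability.LatticeModels.LatticeToContinuumLimit
import HarnessLib

/-!
# Subsequential limits of a renormalised family of bond functions are holomorphic (discrete Cauchy + Morera)

Topic `Literature/Probability/LatticeModels`; the observable-independent form of
`ObservableLimitHolomorphic.lean` (`IsDiscretisation.differentiableOn_of_limit`; Smirnov 2010 §5:
"by Morera's theorem the limit is analytic"), for an abstract family `F δ` of bond functions: if,
on every compact of the open set `D`, eventually in the mesh the family satisfies the discrete
Cauchy–Riemann relations at the sites (vertices) and faces with mesh point in the compact and the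
cross bound `‖F_δ(vertical) - F_δ(horizontal)‖ ≤ L δ√δ`, then every local uniform limit `g` of
`δ^{-1/2} F_δ` (read at horizontal edges, `scaledEdgeFamily`) along a sequence of meshes is
holomorphic on `D`. The discrete contour sum (`boundary_sum_eq_zero_of_cr`), the grid geometry and
the Riemann-sum convergence are those of the tree file verbatim; only the source of the
Cauchy–Riemann relations is abstracted (for the spin fermion of Chelkak–Hongler–Izyurov 2015 they
come from `crVertex_of_isSHolAt`/`crFace_of_isSHolAt` and the bulk / gauged-bulk s-holomorphicity,
`KCObservableBulkBounds.lean`, `SeamGauge.lean`). Everything is proved; no named fact.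

* `wedgeIntegral_add_eq_zero_of_cr` (core, ordered corners, static hypotheses from the start);
* **`differentiableOn_of_limit_of_hyps`**.

## References

* S. Smirnov, Ann. of Math. 172 (2010), Remark 3.3 and §5 [Smirnov2010].
* D. Chelkak, C. Hongler, K. Izyurov, Ann. of Math. 181 (2015), §3.5 (the limit is a holomorphic
  spinor) [ChelkakHonglerIzyurovAnnals2015].
-/

noncomputable section

namespace Literature.Probability.LatticeModels

open Filter _root_.Topology Metric Set Finset Complex

/-- **The discrete contour sum vanishes and its renormalisation converges to `-∮ g`** (generic
family; ordered corners; static estimates from the start). [cite: Smirnov2010, §5 (Morera's theorem)] -/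
theorem wedgeIntegral_add_eq_zero_of_cr {Fm : ℝ → MedialVertex → ℂ} {s : ℕ → ℝ} (hs0 : ∀ k, 0 < s k)
    (hs : Tendsto s atTop (𝓝 0)) {g : ℂ → ℂ} {z w : ℂ} (hre : z.re ≤ w.re) (him : z.im ≤ w.im)
    {K : Set ℂ} (hK : IsCompact K) (hg : ContinuousOn g K) {r : ℝ} (hr : 0 < r)
    (hKR : cthickening r (Rectangle z w) ⊆ K)
    (hconv : TendstoUniformlyOn (scaledEdgeFamily Fm s) g atTop K)
    (hsr : ∀ k, 3 * s k ≤ r)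
    (hCRv : ∀ k, ∀ x : Site 2, meshPoint (s k) x ∈ K → CRVertex (Fm (s k)) x)
    (hCRf : ∀ k, ∀ x : Site 2, meshPoint (s k) x ∈ K → CRFace (Fm (s k)) x)
    {L : ℝ} (hcross : ∀ k, ∀ x : Site 2, meshPoint (s k) x ∈ K →
      ‖Fm (s k) (cSrc (x, 1)) - Fm (s k) (cSrc (x, 0))‖ ≤ L * s k * Real.sqrt (s k)) :
    wedgeIntegral z w g + wedgeIntegral w z g = 0 := by
  -- notation
  set b : ℕ → Site 2 := fun k => nearestSite (s k) z with hb
  set m : ℕ → ℕ := fun k => ⌊(w.re - z.re) / s k⌋₊ with hm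
  set n : ℕ → ℕ := fun k => ⌊(w.im - z.im) / s k⌋₊ with hn
  set F : ∀ k : ℕ, MedialVertex → ℂ := fun k => Fm (s k) with hF
  set u := scaledEdgeFamily Fm s with hu
  set ℓx := w.re - z.re with hℓx
  set ℓy := w.im - z.im with hℓy
  have hℓx0 : 0 ≤ ℓx := by rw [hℓx]; linarith
  have hℓy0 : 0 ≤ ℓy := by rw [hℓy]; linarith
  have hfloorx : ∀ k, (m k : ℝ) * s k ≤ ℓx ∧ ℓx < (m k + 1) * s k := fun k => floor_mul_le_of_le hℓx0 (hs0 k)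
  have hfloory : ∀ k, (n k : ℝ) * s k ≤ ℓy ∧ ℓy < (n k + 1) * s k := fun k => floor_mul_le_of_le hℓy0 (hs0 k)
  -- (a) grid points are in `K`
  have hgridK : ∀ k (i j : ℤ), -1 ≤ i → i ≤ m k + 1 → -1 ≤ j → j ≤ n k + 1 → meshPoint (s k) (vtx (b k) i j) ∈ K := by
    intro k i j hi hi' hj hj'
    have h3 := meshPoint_vtx_mem_cthickening (hs0 k) z w hre him hi hi' hj hj'
    exact hKR (cthickening_mono (hsr k) _ h3)
  -- (c) the discrete contour sum vanishes
  have hBS : ∀ k,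
      ∑ i ∈ Finset.range (m k + 1), (vmid (F k) (b k) i (n k) - vmid (F k) (b k) i (-1)) +
        ∑ i ∈ Finset.range (m k), (hmid (F k) (b k) i (n k) - hmid (F k) (b k) i 0) -
        I * (∑ j ∈ Finset.range (n k + 1), (hmid (F k) (b k) (m k) j - hmid (F k) (b k) (-1) j) +
          ∑ j ∈ Finset.range (n k), (vmid (F k) (b k) (m k) j - vmid (F k) (b k) 0 j)) = 0 := by
    intro k
    refine boundary_sum_eq_zero_of_cr (F k) (b k) (m k) (n k) (fun i j hi hj => ?_) (fun i j hi hj => ?_)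
    · exact hCRv k _ (hgridK k i j (by omega) (by omega) (by omega) (by omega))
    · exact hCRf k _ (hgridK k i j (by omega) (by omega) (by omega) (by omega))
  -- (d) horizontal values in terms of `u`
  have hhor : ∀ k (x : Site 2), F k (cSrc (x, 0)) = (Real.sqrt (s k) : ℂ) * u k (meshPoint (s k) x) := by
    intro k x
    have hsq : (Real.sqrt (s k) : ℂ) ≠ 0 := by exact_mod_cast (Real.sqrt_pos.2 (hs0 k)).ne'
    simp only [hu, hF, scaledEdgeFamily, nearestSite_meshPoint (hs0 k).ne', ← mul_assoc, mul_inv_cancel₀ hsq, one_mul]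
  -- the renormalisation constant `c_k = (s k / 2) (√ s k)⁻¹`, with `c_k √(s k) = s k / 2`
  set c : ℕ → ℂ := fun k => ((s k / 2 : ℝ) : ℂ) * ((Real.sqrt (s k))⁻¹ : ℂ) with hc
  have hc_sqrt : ∀ k, c k * (Real.sqrt (s k) : ℂ) = ((s k / 2 : ℝ) : ℂ) := by
    intro k
    have : (Real.sqrt (s k) : ℂ) ≠ 0 := by exact_mod_cast (Real.sqrt_pos.2 (hs0 k)).ne'
    rw [hc, mul_assoc, inv_mul_cancel₀ this, mul_one]
  -- (e) the four side integrals
  set Itop := ∫ x : ℝ in z.re..w.re, g (x + w.im * I) with hItop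
  set Ibot := ∫ x : ℝ in z.re..w.re, g (x + z.im * I) with hIbot
  set Irig := ∫ y : ℝ in z.im..w.im, g (w.re + y * I) with hIrig
  set Ilef := ∫ y : ℝ in z.im..w.im, g (z.re + y * I) with hIlef
  -- Riemann sums of `u` along rows/columns converge to the side integrals.
  -- rows: `N = m` or `m + 1`, height `h ∈ {z.im, w.im}`, row index `j(k)` with `|z.im + s_k j(k) - h| ≤ s_k`
  have hrow : ∀ (N : ℕ → ℕ) (jr : ℕ → ℤ) (h : ℝ), h ∈ Icc z.im w.im →
      (∀ k, N k = m k ∨ N k = m k + 1) → (∀ k, -1 ≤ jr k ∧ jr k ≤ n k + 1) →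
      (∀ k, |z.im + s k * jr k - h| ≤ s k) →
      Tendsto (fun k => (s k : ℂ) * ∑ t ∈ Finset.range (N k), u k (meshPoint (s k) (vtx (b k) t (jr k)))) atTop
        (𝓝 (∫ x : ℝ in z.re..w.re, g (x + h * I))) := by
    intro N jr h hh hN hjr hjh
    have hNℓ : Tendsto (fun k => (N k : ℝ) * s k) atTop (𝓝 ℓx) := by
      -- squeeze between `m s` and `(m+1) s`, both → ℓx
      have h1 : Tendsto (fun k => (m k : ℝ) * s k) atTop (𝓝 ℓx) := by
        refine tendsto_of_tendsto_of_tendsto_of_le_of_le (g := fun k => ℓx - s k) (h := fun k => ℓx) ?_ tendsto_const_nhds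
          (fun k => by have := (hfloorx k).2; simp only; nlinarith) (fun k => (hfloorx k).1)
        simpa using (tendsto_const_nhds (x := ℓx)).sub hs
      have h2 : Tendsto (fun k => ((m k : ℝ) + 1) * s k) atTop (𝓝 ℓx) := by
        have : Tendsto (fun k => (m k : ℝ) * s k + s k) atTop (𝓝 (ℓx + 0)) := h1.add hs
        rw [add_zero] at this
        exact this.congr fun k => by ring
      refine tendsto_of_tendsto_of_tendsto_of_le_of_le h1 h2 (fun k => ?_) (fun k => ?_)
      · rcases hN k with h' | h' <;> simp only [h'] <;> push_cast <;> nlinarith [hs0 k]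
      · rcases hN k with h' | h' <;> simp only [h'] <;> push_cast <;> nlinarith [hs0 k]
    have key := tendsto_mul_sum_of_tendstoUniformlyOn hK hg hconv hs0 hs hℓx0 hNℓ (p := (h : ℂ) * I) (v := 1)
      (by simp) (a₀ := z.re) (m₀ := r / 2) (by positivity)
      ((row_image_subset_cthickening z w hr hh hre).trans hKR) (C := 2) (by norm_num)
      (P := fun k t => meshPoint (s k) (vtx (b k) t (jr k))) (fun k t ht => ?_) (fun k t ht => ?_)
    · have e : (fun x : ℝ => g ((h : ℂ) * I + (x : ℂ) * 1)) = fun x : ℝ => g (x + h * I) := by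
        funext x; ring_nf
      rw [show z.re + ℓx = w.re by rw [hℓx]; ring, e] at key
      exact key
    · exact hgridK k t (jr k) (by omega) (by rcases hN k with h' | h' <;> omega) (hjr k).1 (hjr k).2
    · calc _ ≤ s k + |z.im + s k * jr k - h| := dist_meshPoint_vtx_row_le (hs0 k) z t (jr k) h
        _ ≤ s k + s k := by gcongr; exact hjh k
        _ = 2 * s k := by ring
  have hcol : ∀ (N : ℕ → ℕ) (ic : ℕ → ℤ) (h : ℝ), h ∈ Icc z.re w.re →
      (∀ k, N k = n k ∨ N k = n k + 1) → (∀ k, -1 ≤ ic k ∧ ic k ≤ m k + 1) →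
      (∀ k, |z.re + s k * ic k - h| ≤ s k) →
      Tendsto (fun k => (s k : ℂ) * ∑ t ∈ Finset.range (N k), u k (meshPoint (s k) (vtx (b k) (ic k) t))) atTop
        (𝓝 (∫ y : ℝ in z.im..w.im, g (h + y * I))) := by
    intro N ic h hh hN hic hih
    have hNℓ : Tendsto (fun k => (N k : ℝ) * s k) atTop (𝓝 ℓy) := by
      have h1 : Tendsto (fun k => (n k : ℝ) * s k) atTop (𝓝 ℓy) := by
        refine tendsto_of_tendsto_of_tendsto_of_le_of_le (g := fun k => ℓy - s k) (h := fun k => ℓy) ?_ tendsto_const_nhds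
          (fun k => by have := (hfloory k).2; simp only; nlinarith) (fun k => (hfloory k).1)
        simpa using (tendsto_const_nhds (x := ℓy)).sub hs
      have h2 : Tendsto (fun k => ((n k : ℝ) + 1) * s k) atTop (𝓝 ℓy) := by
        have : Tendsto (fun k => (n k : ℝ) * s k + s k) atTop (𝓝 (ℓy + 0)) := h1.add hs
        rw [add_zero] at this
        exact this.congr fun k => by ring
      refine tendsto_of_tendsto_of_tendsto_of_le_of_le h1 h2 (fun k => ?_) (fun k => ?_)
      · rcases hN k with h' | h' <;> simp only [h'] <;> push_cast <;> nlinarith [hs0 k]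
      · rcases hN k with h' | h' <;> simp only [h'] <;> push_cast <;> nlinarith [hs0 k]
    have key := tendsto_mul_sum_of_tendstoUniformlyOn hK hg hconv hs0 hs hℓy0 hNℓ (p := (h : ℂ)) (v := I)
      (by simp) (a₀ := z.im) (m₀ := r / 2) (by positivity)
      ((col_image_subset_cthickening z w hr hh him).trans hKR) (C := 2) (by norm_num)
      (P := fun k t => meshPoint (s k) (vtx (b k) (ic k) t)) (fun k t ht => ?_) (fun k t ht => ?_)
    · rw [show z.im + ℓy = w.im by rw [hℓy]; ring] at key
      exact key
    · exact hgridK k (ic k) t (hic k).1 (hic k).2 (by omega) (by rcases hN k with h' | h' <;> omega)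
    · calc _ ≤ s k + |z.re + s k * ic k - h| := dist_meshPoint_vtx_col_le (hs0 k) z (ic k) t h
        _ ≤ s k + s k := by gcongr; exact hih k
        _ = 2 * s k := by ring
  -- the eight renormalised sums, in terms of `u` (horizontal values) plus errors (vertical values)
  -- generic: `c_k Σ_{t<N} F(cSrc(x_t, 0)) = (1/2) (s_k Σ u(meshPoint x_t))`
  have hHsum : ∀ k (N : ℕ) (x : ℕ → Site 2),
      c k * ∑ t ∈ Finset.range N, F k (cSrc (x t, 0)) = (1 / 2 : ℂ) * ((s k : ℂ) * ∑ t ∈ Finset.range N, u k (meshPoint (s k) (x t))) := by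
    intro k N x
    simp_rw [hhor k, ← Finset.mul_sum, ← mul_assoc, hc_sqrt k]
    push_cast; ring
  -- generic: `‖c_k Σ_{t<N} (F(cSrc(x_t,1)) - F(cSrc(x_t,0)))‖ ≤ (L/2) (N s_k) s_k` for grid points
  have hVerr : ∀ k (N : ℕ) (x : ℕ → Site 2), (∀ t, t < N → meshPoint (s k) (x t) ∈ K) →
      ‖c k * ∑ t ∈ Finset.range N, (F k (cSrc (x t, 1)) - F k (cSrc (x t, 0)))‖ ≤ L / 2 * ((N : ℝ) * s k) * s k := by
    intro k N x hx
    have hsq : 0 < Real.sqrt (s k) := Real.sqrt_pos.2 (hs0 k)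
    have hck : ‖c k‖ = s k / 2 * (Real.sqrt (s k))⁻¹ := by
      rw [hc, norm_mul, norm_inv, Complex.norm_real, Complex.norm_real, Real.norm_eq_abs, Real.norm_eq_abs,
        abs_of_pos (by linarith [hs0 k]), abs_of_pos hsq]
    rw [norm_mul, hck]
    calc s k / 2 * (Real.sqrt (s k))⁻¹ * ‖∑ t ∈ Finset.range N, (F k (cSrc (x t, 1)) - F k (cSrc (x t, 0)))‖
        ≤ s k / 2 * (Real.sqrt (s k))⁻¹ * ∑ t ∈ Finset.range N, (L * s k * Real.sqrt (s k)) := by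
          gcongr
          · exact mul_nonneg (by linarith [hs0 k]) (inv_nonneg.2 hsq.le)
          · exact (norm_sum_le _ _).trans (Finset.sum_le_sum fun t ht => hcross k (x t) (hx t (Finset.mem_range.1 ht)))
      _ = L / 2 * ((N : ℝ) * s k) * s k := by
          rw [Finset.sum_const, Finset.card_range, nsmul_eq_mul]
          field_simp
  -- the error terms tend to zero: `(N_k s_k) s_k → ℓ · 0`
  have herr0 : ∀ (N : ℕ → ℕ) (ℓ : ℝ), Tendsto (fun k => (N k : ℝ) * s k) atTop (𝓝 ℓ) →
      ∀ (x : ℕ → ℕ → Site 2), (∀ k t, t < N k → meshPoint (s k) (x k t) ∈ K) →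
      Tendsto (fun k => c k * ∑ t ∈ Finset.range (N k), (F k (cSrc (x k t, 1)) - F k (cSrc (x k t, 0)))) atTop (𝓝 0) := by
    intro N ℓ hN x hx
    rw [tendsto_zero_iff_norm_tendsto_zero]
    have hlim : Tendsto (fun k => L / 2 * ((N k : ℝ) * s k) * s k) atTop (𝓝 0) := by
      have := (hN.const_mul (L / 2)).mul hs
      rw [mul_zero] at this
      exact this
    exact squeeze_zero (fun k => norm_nonneg _) (fun k => hVerr k (N k) (x k) (hx k)) hlim
  -- bookkeeping of the row/column indices
  have hvmid : ∀ k (i j : ℤ), vmid (F k) (b k) i j = F k (cSrc (vtx (b k) i j, 1)) := fun _ _ _ => rfl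
  have hhmid : ∀ k (i j : ℤ), hmid (F k) (b k) i j = F k (cSrc (vtx (b k) i j, 0)) := fun _ _ _ => rfl
  have hmN : Tendsto (fun k => ((m k + 1 : ℕ) : ℝ) * s k) atTop (𝓝 ℓx) := by
    have h1 : Tendsto (fun k => (m k : ℝ) * s k) atTop (𝓝 ℓx) := by
      refine tendsto_of_tendsto_of_tendsto_of_le_of_le (g := fun k => ℓx - s k) (h := fun k => ℓx) ?_ tendsto_const_nhds
        (fun k => by have := (hfloorx k).2; simp only; nlinarith) (fun k => (hfloorx k).1)
      simpa using (tendsto_const_nhds (x := ℓx)).sub hs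
    have : Tendsto (fun k => (m k : ℝ) * s k + s k) atTop (𝓝 (ℓx + 0)) := h1.add hs
    rw [add_zero] at this
    exact this.congr fun k => by push_cast; ring
  have hnN : Tendsto (fun k => ((n k : ℕ) : ℝ) * s k) atTop (𝓝 ℓy) := by
    refine tendsto_of_tendsto_of_tendsto_of_le_of_le (g := fun k => ℓy - s k) (h := fun k => ℓy) ?_ tendsto_const_nhds
      (fun k => by have := (hfloory k).2; simp only; nlinarith) (fun k => (hfloory k).1)
    simpa using (tendsto_const_nhds (x := ℓy)).sub hs
  have hjn : ∀ k, |z.im + s k * (n k : ℕ) - w.im| ≤ s k := by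
    intro k; have h' := hfloory k
    rw [abs_le]; constructor <;> nlinarith [h'.1, h'.2]
  have hj0 : ∀ k, |z.im + s k * ((0 : ℕ) : ℤ) - z.im| ≤ s k := by intro k; simp [(hs0 k).le]
  have hjm1 : ∀ k, |z.im + s k * (-1 : ℤ) - z.im| ≤ s k := by intro k; simp [abs_of_pos (hs0 k)]
  have him_ : ∀ k, |z.re + s k * (m k : ℕ) - w.re| ≤ s k := by
    intro k; have h' := hfloorx k
    rw [abs_le]; constructor <;> nlinarith [h'.1, h'.2]
  have hi0 : ∀ k, |z.re + s k * ((0 : ℕ) : ℤ) - z.re| ≤ s k := by intro k; simp [(hs0 k).le]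
  have him1 : ∀ k, |z.re + s k * (-1 : ℤ) - z.re| ≤ s k := by intro k; simp [abs_of_pos (hs0 k)]
  have hzim : z.im ∈ Icc z.im w.im := ⟨le_rfl, him⟩
  have hwim : w.im ∈ Icc z.im w.im := ⟨him, le_rfl⟩
  have hzre : z.re ∈ Icc z.re w.re := ⟨le_rfl, hre⟩
  have hwre : w.re ∈ Icc z.re w.re := ⟨hre, le_rfl⟩
  -- the eight limits
  -- A2: top row, horizontal values
  have LA2 : Tendsto (fun k => c k * ∑ i ∈ Finset.range (m k), hmid (F k) (b k) i (n k)) atTop (𝓝 ((1 / 2 : ℂ) * Itop)) := by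
    have h := (hrow m (fun k => n k) w.im hwim (fun k => Or.inl rfl) (fun k => ⟨by omega, by omega⟩) hjn).const_mul (1 / 2 : ℂ)
    refine h.congr fun k => ?_
    simp_rw [hhmid]; exact (hHsum k (m k) fun t => vtx (b k) t (n k)).symm
  -- B2: bottom row `j = 0`, horizontal values
  have LB2 : Tendsto (fun k => c k * ∑ i ∈ Finset.range (m k), hmid (F k) (b k) i 0) atTop (𝓝 ((1 / 2 : ℂ) * Ibot)) := by
    have h := (hrow m (fun _ => 0) z.im hzim (fun k => Or.inl rfl) (fun k => ⟨by omega, by omega⟩)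
      (fun k => by simpa using hj0 k)).const_mul (1 / 2 : ℂ)
    refine h.congr fun k => ?_
    simp_rw [hhmid]; exact (hHsum k (m k) fun t => vtx (b k) t 0).symm
  -- C1: right column `i = m`, horizontal values
  have LC1 : Tendsto (fun k => c k * ∑ j ∈ Finset.range (n k + 1), hmid (F k) (b k) (m k) j) atTop (𝓝 ((1 / 2 : ℂ) * Irig)) := by
    have h := (hcol (fun k => n k + 1) (fun k => m k) w.re hwre (fun k => Or.inr rfl) (fun k => ⟨by omega, by omega⟩) him_).const_mul (1 / 2 : ℂ)
    refine h.congr fun k => ?_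
    simp_rw [hhmid]; exact (hHsum k (n k + 1) fun t => vtx (b k) (m k) t).symm
  -- D1: left column `i = -1`, horizontal values
  have LD1 : Tendsto (fun k => c k * ∑ j ∈ Finset.range (n k + 1), hmid (F k) (b k) (-1) j) atTop (𝓝 ((1 / 2 : ℂ) * Ilef)) := by
    have h := (hcol (fun k => n k + 1) (fun _ => -1) z.re hzre (fun k => Or.inr rfl) (fun k => ⟨by omega, by omega⟩) him1).const_mul (1 / 2 : ℂ)
    refine h.congr fun k => ?_
    simp_rw [hhmid]; exact (hHsum k (n k + 1) fun t => vtx (b k) (-1) t).symm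
  -- vertical values: split `V = Hh + (V - Hh)`
  have hVsplit : ∀ k (N : ℕ) (x : ℕ → Site 2), c k * ∑ t ∈ Finset.range N, F k (cSrc (x t, 1)) =
      c k * ∑ t ∈ Finset.range N, F k (cSrc (x t, 0)) + c k * ∑ t ∈ Finset.range N, (F k (cSrc (x t, 1)) - F k (cSrc (x t, 0))) := by
    intro k N x; rw [← mul_add, ← Finset.sum_add_distrib]; congr 1
    exact Finset.sum_congr rfl fun t _ => by ring
  -- A1: top row, vertical values
  have LA1 : Tendsto (fun k => c k * ∑ i ∈ Finset.range (m k + 1), vmid (F k) (b k) i (n k)) atTop (𝓝 ((1 / 2 : ℂ) * Itop)) := by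
    have h1 := (hrow (fun k => m k + 1) (fun k => n k) w.im hwim (fun k => Or.inr rfl) (fun k => ⟨by omega, by omega⟩) hjn).const_mul (1 / 2 : ℂ)
    have h2 := herr0 (fun k => m k + 1) ℓx hmN (fun k t => vtx (b k) t (n k))
      (fun k t ht => hgridK k t (n k) (by omega) (by omega) (by omega) (by omega))
    have h := h1.add h2
    rw [add_zero] at h
    refine h.congr fun k => ?_
    simp_rw [hvmid]; rw [hVsplit, hHsum]
  -- B1: bottom row `j = -1`, vertical values
  have LB1 : Tendsto (fun k => c k * ∑ i ∈ Finset.range (m k + 1), vmid (F k) (b k) i (-1)) atTop (𝓝 ((1 / 2 : ℂ) * Ibot)) := by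
    have h1 := (hrow (fun k => m k + 1) (fun _ => -1) z.im hzim (fun k => Or.inr rfl) (fun k => ⟨by omega, by omega⟩) hjm1).const_mul (1 / 2 : ℂ)
    have h2 := herr0 (fun k => m k + 1) ℓx hmN (fun k t => vtx (b k) t (-1))
      (fun k t ht => hgridK k t (-1) (by omega) (by omega) (by omega) (by omega))
    have h := h1.add h2
    rw [add_zero] at h
    refine h.congr fun k => ?_
    simp_rw [hvmid]; rw [hVsplit, hHsum]
  -- C2: right column, vertical values
  have LC2 : Tendsto (fun k => c k * ∑ j ∈ Finset.range (n k), vmid (F k) (b k) (m k) j) atTop (𝓝 ((1 / 2 : ℂ) * Irig)) := by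
    have h1 := (hcol n (fun k => m k) w.re hwre (fun k => Or.inl rfl) (fun k => ⟨by omega, by omega⟩) him_).const_mul (1 / 2 : ℂ)
    have h2 := herr0 n ℓy hnN (fun k t => vtx (b k) (m k) t)
      (fun k t ht => hgridK k (m k) t (by omega) (by omega) (by omega) (by omega))
    have h := h1.add h2
    rw [add_zero] at h
    refine h.congr fun k => ?_
    simp_rw [hvmid]; rw [hVsplit, hHsum]
  -- D2: left column `i = 0`, vertical values
  have LD2 : Tendsto (fun k => c k * ∑ j ∈ Finset.range (n k), vmid (F k) (b k) 0 j) atTop (𝓝 ((1 / 2 : ℂ) * Ilef)) := by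
    have h1 := (hcol n (fun _ => 0) z.re hzre (fun k => Or.inl rfl) (fun k => ⟨by omega, by omega⟩)
      (fun k => by simpa using hi0 k)).const_mul (1 / 2 : ℂ)
    have h2 := herr0 n ℓy hnN (fun k t => vtx (b k) 0 t)
      (fun k t ht => hgridK k 0 t (by omega) (by omega) (by omega) (by omega))
    have h := h1.add h2
    rw [add_zero] at h
    refine h.congr fun k => ?_
    simp_rw [hvmid]; rw [hVsplit, hHsum]
  -- the renormalised contour sum `T k = c k * BS k = 0` and its limit
  have hT : Tendsto (fun k => (c k * ∑ i ∈ Finset.range (m k + 1), vmid (F k) (b k) i (n k) -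
        c k * ∑ i ∈ Finset.range (m k + 1), vmid (F k) (b k) i (-1)) +
      (c k * ∑ i ∈ Finset.range (m k), hmid (F k) (b k) i (n k) - c k * ∑ i ∈ Finset.range (m k), hmid (F k) (b k) i 0) -
      I * ((c k * ∑ j ∈ Finset.range (n k + 1), hmid (F k) (b k) (m k) j -
          c k * ∑ j ∈ Finset.range (n k + 1), hmid (F k) (b k) (-1) j) +
        (c k * ∑ j ∈ Finset.range (n k), vmid (F k) (b k) (m k) j - c k * ∑ j ∈ Finset.range (n k), vmid (F k) (b k) 0 j)))
      atTop (𝓝 (((1 / 2 : ℂ) * Itop - (1 / 2 : ℂ) * Ibot) + ((1 / 2 : ℂ) * Itop - (1 / 2 : ℂ) * Ibot) -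
        I * (((1 / 2 : ℂ) * Irig - (1 / 2 : ℂ) * Ilef) + ((1 / 2 : ℂ) * Irig - (1 / 2 : ℂ) * Ilef)))) :=
    ((LA1.sub LB1).add (LA2.sub LB2)).sub (((LC1.sub LD1).add (LC2.sub LD2)).const_mul I)
  have hT0 : ∀ k, (c k * ∑ i ∈ Finset.range (m k + 1), vmid (F k) (b k) i (n k) -
        c k * ∑ i ∈ Finset.range (m k + 1), vmid (F k) (b k) i (-1)) +
      (c k * ∑ i ∈ Finset.range (m k), hmid (F k) (b k) i (n k) - c k * ∑ i ∈ Finset.range (m k), hmid (F k) (b k) i 0) -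
      I * ((c k * ∑ j ∈ Finset.range (n k + 1), hmid (F k) (b k) (m k) j -
          c k * ∑ j ∈ Finset.range (n k + 1), hmid (F k) (b k) (-1) j) +
        (c k * ∑ j ∈ Finset.range (n k), vmid (F k) (b k) (m k) j - c k * ∑ j ∈ Finset.range (n k), vmid (F k) (b k) 0 j)) = 0 := by
    intro k
    have h := congrArg (fun t => c k * t) (hBS k)
    simp only [mul_zero, Finset.sum_sub_distrib] at h
    rw [← h]; ring
  have hlim0 : ((1 / 2 : ℂ) * Itop - (1 / 2 : ℂ) * Ibot) + ((1 / 2 : ℂ) * Itop - (1 / 2 : ℂ) * Ibot) -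
      I * (((1 / 2 : ℂ) * Irig - (1 / 2 : ℂ) * Ilef) + ((1 / 2 : ℂ) * Irig - (1 / 2 : ℂ) * Ilef)) = 0 := by
    refine tendsto_nhds_unique hT ?_
    exact tendsto_const_nhds.congr fun k => (hT0 k).symm
  rw [Complex.wedgeIntegral_add_wedgeIntegral_eq]
  simp only [smul_eq_mul]
  linear_combination (-1 : ℂ) * hlim0


/-- **Subsequential limits of `δ^{-1/2} F_δ` are holomorphic**, for a family with eventual
Cauchy–Riemann relations and cross bound on compacts. [cite: Smirnov2010, §5 (proof of Theorem 2.2, Morera step); ChelkakHonglerIzyurovAnnals2015, §3.5] -/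
theorem differentiableOn_of_limit_of_hyps {Fm : ℝ → MedialVertex → ℂ} {D : Set ℂ} (hD : IsOpen D)
    (hCR : ∀ K ⊆ D, IsCompact K → ∀ᶠ δ in 𝓝[>] (0 : ℝ), ∀ x : Site 2, meshPoint δ x ∈ K →
      CRVertex (Fm δ) x ∧ CRFace (Fm δ) x)
    (hX : ∀ K ⊆ D, IsCompact K → ∃ L : ℝ, ∀ᶠ δ in 𝓝[>] (0 : ℝ), ∀ x : Site 2, meshPoint δ x ∈ K →
      ‖Fm δ (cSrc (x, 1)) - Fm δ (cSrc (x, 0))‖ ≤ L * δ * Real.sqrt δ)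
    {s : ℕ → ℝ} (hs : Tendsto s atTop (𝓝[>] (0 : ℝ))) {g : ℂ → ℂ} (hg : ContinuousOn g D)
    (hconv : ∀ K ⊆ D, IsCompact K → TendstoUniformlyOn (scaledEdgeFamily Fm s) g atTop K) :
    DifferentiableOn ℂ g D := by
  -- main case: ordered corners
  have main : ∀ z w : ℂ, z.re ≤ w.re → z.im ≤ w.im → Rectangle z w ⊆ D →
      wedgeIntegral z w g + wedgeIntegral w z g = 0 := by
    intro z w hre him hR
    have hRc : IsCompact (Rectangle z w) := isCompact_uIcc.reProdIm isCompact_uIcc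
    obtain ⟨r, hr, hrD⟩ := hRc.exists_cthickening_subset_open hD hR
    set K := cthickening r (Rectangle z w) with hKdef
    have hK : IsCompact K := hRc.cthickening
    have hKD : K ⊆ D := hrD
    have hcr := hCR K hKD hK
    obtain ⟨L, hcross⟩ := hX K hKD hK
    have hsmall : ∀ᶠ δ in 𝓝[>] (0 : ℝ), δ < r / 3 := nhdsWithin_le_nhds (Iio_mem_nhds (by positivity))
    have hall := hs.eventually ((hcr.and hcross).and
      (hsmall.and (self_mem_nhdsWithin : ∀ᶠ δ in 𝓝[>] (0 : ℝ), 0 < δ)))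
    obtain ⟨k₀, hk₀⟩ := eventually_atTop.1 hall
    -- shift the sequence
    set s' : ℕ → ℝ := fun k => s (k + k₀) with hs'
    have hk : ∀ k, ((∀ x : Site 2, meshPoint (s' k) x ∈ K → CRVertex (Fm (s' k)) x ∧ CRFace (Fm (s' k)) x) ∧
        (∀ x : Site 2, meshPoint (s' k) x ∈ K →
          ‖Fm (s' k) (cSrc (x, 1)) - Fm (s' k) (cSrc (x, 0))‖ ≤ L * s' k * Real.sqrt (s' k))) ∧
        (s' k < r / 3 ∧ 0 < s' k) := fun k => hk₀ (k + k₀) (Nat.le_add_left _ _)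
    have hs'0 : ∀ k, 0 < s' k := fun k => (hk k).2.2
    have hs'lim : Tendsto s' atTop (𝓝 0) := (hs.mono_right nhdsWithin_le_nhds).comp (tendsto_add_atTop_nat k₀)
    have hconv' : TendstoUniformlyOn (scaledEdgeFamily Fm s') g atTop K := tendstoUniformlyOn_shift (hconv K hKD hK) k₀
    refine wedgeIntegral_add_eq_zero_of_cr hs'0 hs'lim hre him hK (hg.mono hKD) hr Subset.rfl hconv'
      (fun k => ?_) (fun k x hx => ((hk k).1.1 x hx).1) (fun k x hx => ((hk k).1.1 x hx).2) (fun k x hx => (hk k).1.2 x hx)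
    have := (hk k).2.1; linarith
  -- all corner configurations
  have aux : ∀ z w : ℂ, z.re ≤ w.re → Rectangle z w ⊆ D → wedgeIntegral z w g + wedgeIntegral w z g = 0 := by
    intro z w hre hR
    rcases le_total z.im w.im with him | him
    · exact main z w hre him hR
    · have hR' : Rectangle (⟨z.re, w.im⟩ : ℂ) ⟨w.re, z.im⟩ ⊆ D := by rwa [rectangle_eq_of_diag]
      have h := main ⟨z.re, w.im⟩ ⟨w.re, z.im⟩ hre him hR'
      rw [Complex.wedgeIntegral_add_wedgeIntegral_eq] at h ⊢
      simp only at h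
      rw [intervalIntegral.integral_symm z.im w.im, intervalIntegral.integral_symm z.im w.im] at h
      linear_combination (-1 : ℂ) * h
  refine ((Complex.isConservativeOn_and_continuousOn_iff_isDifferentiableOn hD).1 ⟨?_, hg⟩)
  intro z w hR
  rcases le_total z.re w.re with hre | hre
  · exact eq_neg_of_add_eq_zero_left (aux z w hre hR)
  · have hR' : Rectangle w z ⊆ D := by
      rwa [show Rectangle w z = Rectangle z w by simp [Rectangle, Set.uIcc_comm]]
    have h := aux w z hre hR'
    rw [add_comm] at h
    exact eq_neg_of_add_eq_zero_left h

end Literature.Probability.LatticeModels
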